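import Summits.FinalStateConjecture.FinalStateConjecture.Theorems.LaminatedThresholdTameExitsLocaliseSquash
import Literature.Geometry.Lorentzian.CoordKIDEquations
import Literature.Geometry.Lorentzian.AdmissibleDataLocality
import Literature.Geometry.Lorentzian.TameGenericityLocal
import Literature.Geometry.Lorentzian.TameGenericityDiagonal
import Literature.Geometry.Lorentzian.TameGenericityLocalWindowImmersed
import Literature.Geometry.Lorentzian.AFEndRestrict
import HarnessLib

/-!
# Crux `TameExitsLocalise` (stmt-FinalStateConjecture-16894), line `birth`, stub S1
# `stub_parametricTailGluing` — reduction to PARAMETRIC KID-FREE ANNULAR GLUING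

Route `route-FinalStateConjecture-LaminatedThreshold`, crux B (`Theses.LaminatedThreshold.TameExitsLocalise`),
skeleton `Cruxes/TameExitsLocalise/Lines/birth.lean` (planner-skel, sha 766c7d98…), stub S1
`stub_parametricTailGluing : ParametricTailGluing` (the ELLIPTIC half of the line: localise a tame exit by
gluing its members `F c` to the EXACT tail of `d⋆` across a KID-free far annulus of the sole end `e`).

`parametricTailGluing_of_annularGluing` proves `ParametricTailGluing` (stated here UNFOLDED, verbatim in the
Literature vocabulary; the Cruxes file is not importable from `Theorems/`) from ONE explicit hypothesis, the
parametric KID-free annular gluing of Chruściel–Delay / Corvino–Schoen: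

> for an end `e` of `X`, a datum `D`, a jointly smooth curve `F` of VACUUM data through `D = F 0` and a chart
> annulus `{R₁ < ‖y‖ < R₂}` of `e` (`e.R ≤ R₁`) carrying no non-trivial chart KID of `D`, there are `ε₁ > 0`
> and a jointly smooth curve `G` through `D` such that for `‖c‖ < ε₁` the datum `G c` is vacuum, equals `D`
> on `e.far R₂` and equals `F c` off `e.far R₁`

(Chruściel–Delay, Mém. SMF 94 (2003), Thm 5.9 / Prop 5.10 / Cor 5.11; J. Geom. Phys. 51 (2004), Thm 6.6;
Corvino–Schoen, J. Differential Geom. 73 (2006), Thm 2 — proposed separately as the Literature named fact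
`ChruscielDelay_parametricAnnularGluing`; it is written here as a HYPOTHESIS, not a definition, so that this
file is a pure proof). Everything else is bookkeeping over the tree:

1. the immersion marker of `F` at `0` (`IsImmersedAtZero 1 F`: a point `x₀` and a scalar component with
   non-zero `c`-derivative) is pushed inside the gluing radius — `AFEnd.exists_forall_far_disjoint` gives `Rx`
   with `x₀ ∉ e.far R` for `R ≥ Rx`, and the no-Killing-tail hypothesis is invoked beyond `max R₀ Rx`;
2. the glued curve `G` agrees with `F` at `x₀` for `‖c‖ < ε₁`, so it is immersed at `0`
   (`Filter.EventuallyEq.fderiv_eq`, linearity of `fderiv` in the direction on `ℝ¹`);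
3. hence `G` is injective on a window `‖c‖ < δ` (`exists_window_injective_of_isImmersedAtZero`);
4. the squash `φ` of `exists_contDiff_squash_eqOn` (smooth, injective, `‖φ c‖ < min δ ε₁`, `φ = id` near `0`)
   folds the line into the window: `F' := G ∘ φ` is jointly smooth (`IsSmoothDataFamily.comp_contDiff`),
   immersed at `0` (`IsImmersedAtZero.comp_of_injective_fderiv`, `dφ₀ = id`), injective, through `d⋆`;
5. every `F' c` is vacuum and equals `d⋆` on `e.far R₂`, whose complement is compact because `e` is the sole
   end (`IsTameDataFamily` carries `e.IsSoleEnd`; `AFEnd.IsSoleEnd.isCompact_compl_far`), so it is admissible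
   (`InitialDataSet.mem_admissibleVacuumData_of_agree_off_compact`) and agrees with `d⋆` off that compact set;
6. for `‖c‖ < δ'` (where `φ c = c`) `F' c = G c = F c` off `e.far R₁`.

Tameness of `F` is used only through joint smoothness and soleness of `e`.
-/

noncomputable section

set_option linter.dupNamespace false

open Set Filter Function Topology
open scoped Manifold ContDiff
open Literature.Geometry.Lorentzian Literature.Geometry.Lorentzian.InitialDataSet

namespace Summit.FinalStateConjecture.FinalStateConjecture.Theorems.LaminatedThreshold.TailGluing

/-- **S1 `stub_parametricTailGluing` of line `birth` from parametric KID-free annular gluing.** The hypothesis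
is the Chruściel–Delay / Corvino–Schoen parametric annular gluing (see the module docstring); the conclusion is
`Cruxes.TameExitsLocalise.Birth.ParametricTailGluing` unfolded verbatim (`NoKillingTail`, `HasChartKID`
inlined). Proof: steps 1–6 of the module docstring. [cite: ChruscielDelay2003, Thm 5.9, Cor 5.11]
[cite: CorvinoSchoen2006, Thm 2] [cite: Christodoulou1999, p. A24] -/
theorem parametricTailGluing_of_annularGluing : (∀ (X : Type) [TopologicalSpace X] [ChartedSpace Literature.Geometry.Lorentzian.E3 X] [IsManifold (𝓡 3) ((⊤ : ℕ∞) : WithTop ℕ∞) X] [T2Space X] [SecondCountableTopology X] [ConnectedSpace X] (e : Literature.Geometry.Lorentzian.AFEnd X) (D : Literature.Geometry.Lorentzian.InitialDataSet (𝓡 3) X) (F : EuclideanSpace ℝ (Fin 1) → Literature.Geometry.Lorentzian.InitialDataSet (𝓡 3) X) (R₁ R₂ : ℝ), e.R ≤ R₁ → R₁ < R₂ → Literature.Geometry.Lorentzian.InitialDataSet.IsSmoothDataFamily 1 F → F 0 = D → (∀ c, (∀ [(F c).metric.HasLeviCivita], (F c).IsVacuumConstraintSolution)) → ¬ (∃ (N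 : Literature.Geometry.Lorentzian.E3 → ℝ) (Y : Literature.Geometry.Lorentzian.E3 → Literature.Geometry.Lorentzian.E3), ContDiffOn ℝ ((⊤ : ℕ∞) : WithTop ℕ∞) N {y | R₁ < ‖y‖ ∧ ‖y‖ < R₂} ∧ ContDiffOn ℝ ((⊤ : ℕ∞) : WithTop ℕ∞) Y {y | R₁ < ‖y‖ ∧ ‖y‖ < R₂} ∧ (∃ y, R₁ < ‖y‖ ∧ ‖y‖ < R₂ ∧ (N y ≠ 0 ∨ Y y ≠ 0)) ∧ ∀ y, R₁ < ‖y‖ → ‖y‖ < R₂ → Literature.Geometry.Lorentzian.MetricCoord.adjHamG (e.hCoeff D) (e.kCoeff D) N y + Literature.Geometry.Lorentzian.MetricCoord.adjMomGS (e.hCoeff D) (e.kCoeff D) Y y = 0 ∧ Literature.Geometry.Lorentzian.MetricCoord.adjHamK (e.hCoeff D) (e.kCoeff D) N y + Literature.Geometry.Lorentzian.MetricCoord.adjMomKS (e.hCoeff D) Y y = 0) → ∃ (G : EuclideanSpace ℝ (Fin 1) → Literature.Geometry.Lorentzian.InitialDataSet (𝓡 3) X) (ε₁ : ℝ), 0 <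 ε₁ ∧ Literature.Geometry.Lorentzian.InitialDataSet.IsSmoothDataFamily 1 G ∧ G 0 = D ∧ ∀ c, ‖c‖ < ε₁ → (∀ [(G c).metric.HasLeviCivita], (G c).IsVacuumConstraintSolution) ∧ (∀ x ∈ e.far R₂, (G c).h.inner x = D.h.inner x ∧ (G c).k x = D.k x) ∧ ∀ x ∉ e.far R₁, (G c).h.inner x = (F c).h.inner x ∧ (G c).k x = (F c).k x) → ∀ (X : Type) [TopologicalSpace X] [ChartedSpace Literature.Geometry.Lorentzian.E3 X] [IsManifold (𝓡 3) ((⊤ : ℕ∞) : WithTop ℕ∞) X] [T2Space X] [SecondCountableTopology X] [ConnectedSpace X] (e : Literature.Geometry.Lorentzian.AFEnd X) (dstar : Literature.Geometry.Lorentzian.InitialDataSet (𝓡 3) X) (F : EuclideanSpace ℝ (Fin 1) → Literature.Geometry.Lorentzian.InitialDataSet (𝓡 3) X), dstar ∈ Literature.Geometry.Lorentzian.admissibleVacuumData X → Literature.Geometry.Lorentzian.InitialDataSet.IsTameDataFamily e 1 F → Literature.Geometry.Lorentzian.InitialDataSet.IsImmersedAtZero 1 F → F 0 = dstar → Function.Injective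 F → (∀ c, F c ∈ Literature.Geometry.Lorentzian.admissibleVacuumData X) → (∀ R₀ : ℝ, ∃ R₁ R₂ : ℝ, R₀ ≤ R₁ ∧ e.R ≤ R₁ ∧ R₁ < R₂ ∧ ¬ (∃ (N : Literature.Geometry.Lorentzian.E3 → ℝ) (Y : Literature.Geometry.Lorentzian.E3 → Literature.Geometry.Lorentzian.E3), ContDiffOn ℝ ((⊤ : ℕ∞) : WithTop ℕ∞) N {y | R₁ < ‖y‖ ∧ ‖y‖ < R₂} ∧ ContDiffOn ℝ ((⊤ : ℕ∞) : WithTop ℕ∞) Y {y | R₁ < ‖y‖ ∧ ‖y‖ < R₂} ∧ (∃ y, R₁ < ‖y‖ ∧ ‖y‖ < R₂ ∧ (N y ≠ 0 ∨ Y y ≠ 0)) ∧ ∀ y, R₁ < ‖y‖ → ‖y‖ < R₂ → Literature.Geometry.Lorentzian.MetricCoord.adjHamG (e.hCoeff dstar) (e.kCoeff dstar) N y + Literature.Geometry.Lorentzian.MetricCoord.adjMomGS (e.hCoeff dstar) (e.kCoeff dstar) Y y = 0 ∧ Literature.Geometry.Lorentzian.MetricCoord.adjHamK (e.hCoeff dstar)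 (e.kCoeff dstar) N y + Literature.Geometry.Lorentzian.MetricCoord.adjMomKS (e.hCoeff dstar) Y y = 0)) → ∀ R₀ : ℝ, ∃ R₁ : ℝ, R₀ ≤ R₁ ∧ ∃ (F' : EuclideanSpace ℝ (Fin 1) → Literature.Geometry.Lorentzian.InitialDataSet (𝓡 3) X) (ε₁ : ℝ), Literature.Geometry.Lorentzian.InitialDataSet.IsSmoothDataFamily 1 F' ∧ Literature.Geometry.Lorentzian.InitialDataSet.IsImmersedAtZero 1 F' ∧ F' 0 = dstar ∧ Function.Injective F' ∧ (∀ c, F' c ∈ Literature.Geometry.Lorentzian.admissibleVacuumData X) ∧ (∃ C : Set X, IsCompact C ∧ ∀ c, ∀ x ∉ C, (F' c).h.inner x = dstar.h.inner x ∧ (F' c).k x = dstar.k x) ∧ 0 < ε₁ ∧ ∀ c, ‖c‖ < ε₁ → ∀ x ∉ e.far R₁, (F' c).h.inner x = (F c).h.inner x ∧ (F' c).k x = (F c).k x := by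
  intro hglue X _ _ _ _ _ _ e dstar F hadm hT himm h0 hinj hFadm hNKT R₀
  classical
  -- Step 1: the immersion marker of `F` at `0`
  have hv : (EuclideanSpace.single 0 (1 : ℝ) : EuclideanSpace ℝ (Fin 1)) ≠ 0 := by
    intro h
    have := congrArg (fun v : EuclideanSpace ℝ (Fin 1) ↦ v 0) h
    simp at this
  obtain ⟨x₀, u₀, w₀, hmark⟩ := himm _ hv
  -- Step 1': a radius beyond the marker point, and the KID-free annulus beyond `max R₀ Rx`
  obtain ⟨Rx, hRx⟩ := e.exists_forall_far_disjoint (isCompact_singleton (x := x₀))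
  obtain ⟨R₁, R₂, hR₀₁, heR₁, hR₁₂, hnokid⟩ := hNKT (max R₀ Rx)
  have hR₀le : R₀ ≤ R₁ := (le_max_left _ _).trans hR₀₁
  have hRxle : Rx ≤ R₁ := (le_max_right _ _).trans hR₀₁
  have hx₀far : x₀ ∉ e.far R₁ := fun hx ↦
    Set.disjoint_left.1 (hRx R₁ hRxle) hx (Set.mem_singleton x₀)
  -- Step 2: glue (the hypothesis)
  have hFvac : ∀ c, ∀ [(F c).metric.HasLeviCivita], (F c).IsVacuumConstraintSolution := by
    intro c _
    exact isVacuumConstraintSolution_of_mem_admissibleVacuumData (hFadm c)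
  obtain ⟨G, ε₁, hε₁, hGs, hG0, hG⟩ :=
    hglue X e dstar F R₁ R₂ heR₁ hR₁₂ hT.isSmoothDataFamily h0 hFvac hnokid
  -- Step 2': `G` is immersed at `0` (it agrees with `F` at the marker point for small `c`)
  have hGimm : IsImmersedAtZero 1 G := by
    have hev : ∀ᶠ c in 𝓝 (0 : EuclideanSpace ℝ (Fin 1)),
        (G c).h.inner x₀ = (F c).h.inner x₀ ∧ (G c).k x₀ = (F c).k x₀ := by
      filter_upwards [Metric.ball_mem_nhds (0 : EuclideanSpace ℝ (Fin 1)) hε₁] with c hc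
      rw [Metric.mem_ball, dist_zero_right] at hc
      exact (hG c hc).2.2 x₀ hx₀far
    intro v hv'
    have hv0 : v 0 ≠ 0 := by
      intro h
      apply hv'
      ext i
      have hi : i = 0 := Subsingleton.elim i 0
      subst hi
      simpa using h
    have hveq : v = (v 0) • (EuclideanSpace.single 0 (1 : ℝ) : EuclideanSpace ℝ (Fin 1)) := by
      ext i
      have hi : i = 0 := Subsingleton.elim i 0
      subst hi
      simp
    refine ⟨x₀, u₀, w₀, ?_⟩
    have h₁ : (fun c ↦ (G c).h.inner x₀ u₀ w₀) =ᶠ[𝓝 0] fun c ↦ (F c).h.inner x₀ u₀ w₀ :=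
      hev.mono fun c hc ↦ by simp only [hc.1]
    have h₂ : (fun c ↦ (G c).k x₀ u₀ w₀) =ᶠ[𝓝 0] fun c ↦ (F c).k x₀ u₀ w₀ :=
      hev.mono fun c hc ↦ by simp only [hc.2]
    rw [h₁.fderiv_eq, h₂.fderiv_eq, hveq]
    simp only [map_smul]
    rcases hmark with h | h
    · exact Or.inl (smul_ne_zero hv0 h)
    · exact Or.inr (smul_ne_zero hv0 h)
  -- Step 3: window injectivity of `G`
  obtain ⟨δ, hδ, hGinj⟩ := exists_window_injective_of_isImmersedAtZero hGs hGimm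
  -- Step 4: squash the line into the window `min δ ε₁`, keeping the parameter near `0`
  obtain ⟨φ, δ', hδ', hφs, hφinj, hφlt, hφid⟩ := exists_contDiff_squash_eqOn (lt_min hδ hε₁)
  have hφδ : ∀ c, ‖φ c‖ < δ := fun c ↦ (hφlt c).trans_le (min_le_left _ _)
  have hφε : ∀ c, ‖φ c‖ < ε₁ := fun c ↦ (hφlt c).trans_le (min_le_right _ _)
  have hφ0 : φ 0 = 0 := hφid 0 (by simpa using hδ')
  have hφev : φ =ᶠ[𝓝 0] id := by
    filter_upwards [Metric.ball_mem_nhds (0 : EuclideanSpace ℝ (Fin 1)) hδ'] with c hc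
    rw [Metric.mem_ball, dist_zero_right] at hc
    exact hφid c hc
  have hdφ : fderiv ℝ φ 0 = ContinuousLinearMap.id ℝ (EuclideanSpace ℝ (Fin 1)) := by
    rw [hφev.fderiv_eq, fderiv_id]
  -- Step 5: soleness of `e`, compact complement of the far region
  have hsole : e.IsSoleEnd := hT.2.1
  have hKc : IsCompact (e.far R₂)ᶜ := hsole.isCompact_compl_far R₂
  have hGfar : ∀ c, ∀ x ∉ (e.far R₂)ᶜ,
      (G (φ c)).h.inner x = dstar.h.inner x ∧ (G (φ c)).k x = dstar.k x :=
    fun c x hx ↦ (hG (φ c) (hφε c)).2.1 x (Set.notMem_compl_iff.1 hx)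
  refine ⟨R₁, hR₀le, fun c ↦ G (φ c), δ', hGs.comp_contDiff hφs, ?_, ?_, ?_, ?_,
    ⟨(e.far R₂)ᶜ, hKc, hGfar⟩, hδ', ?_⟩
  · -- immersed at `0`: `dφ₀ = id` is injective
    refine hGimm.comp_of_injective_fderiv hφ0 (hφs.differentiable (by simp) 0) ?_
    rw [hdφ]
    exact fun a b h ↦ h
  · -- through `d⋆`
    show G (φ 0) = dstar
    rw [hφ0, hG0]
  · -- injective
    intro c c' h
    exact hφinj (hGinj _ _ (hφδ c) (hφδ c') h)
  · -- admissible: vacuum and equal to `d⋆` off the compact `(e.far R₂)ᶜ`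
    intro c
    exact mem_admissibleVacuumData_of_agree_off_compact hadm (hG (φ c) (hφε c)).1 hKc (hGfar c)
  · -- Step 6: core agreement with `F c` on the window where `φ c = c`
    intro c hc x hx
    have hcε : ‖c‖ < ε₁ := by
      have h := hφε c
      rwa [hφid c hc] at h
    show (G (φ c)).h.inner x = (F c).h.inner x ∧ (G (φ c)).k x = (F c).k x
    rw [hφid c hc]
    exact (hG c hcε).2.2 x hx

end Summit.FinalStateConjecture.FinalStateConjecture.Theorems.LaminatedThreshold.TailGluing

end
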